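import Literature.Barriers.QuantumAdvantage.BoundedEntanglement
import Mathlib.LinearAlgebra.Matrix.PosDef
import Mathlib.Analysis.Matrix.Order
import HarnessLib

/-!
# The cone of fully separable `n`-qubit operators, separable states, and their local stability

Topic `Literature/Computability/QuantumComplexity` (next to `QuantumMarginals.IsDensity`;
operators on the register `QReg n = Fin n → Bool` of `Literature/Computability/Cryptography`).
Definition request `defn-FullySeparableCone` of route `QuantumAdvantage/SeparableFrames`
(items `SeparableInstancesInBPP`, `TwoQubitFrameExactness`, `FactorTwoLemma`), which today
inline the condition "`M = Σᵢ wᵢ |φᵢ⟩⟨φᵢ|` with `wᵢ ≥ 0` and each `φᵢ` a `1`-blocked (= fully product)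
vector" through `Literature.Barriers.QuantumAdvantage.IsPBlocked 1`.

Source: I. Bengtsson, K. Życzkowski, *Geometry of Quantum States*, 2nd ed. (2017),
Definition 16.2, eq. (16.50): a state is *separable* if it is a convex sum of product states
`ρ = Σⱼ qⱼ ρⱼᴬ ⊗ ρⱼᴮ`, `qⱼ ≥ 0`, `Σ qⱼ = 1` ("first stated clearly by Werner (1989)"), the separable
states forming a convex body "whose extreme points are separable pure states". Here: the fully
multipartite (`n` single-qubit factors) version, as the positive cone generated by the projectors
onto product PURE states — which is the same cone, since every product of positive semidefinite
single-qubit operators is a nonnegative combination of product projectors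
(`productOp_mem_fullySeparableCone`, proved).

## Contents (namespace `Literature.Computability.QuantumComplexity`; everything PROVED, no named facts)

* `productVec u = ⊗ⱼ uⱼ` (`(⊗ⱼuⱼ)(x) = ∏ⱼ uⱼ(xⱼ)`), `isPBlocked_one_productVec`, and the
  identification **`isPBlocked_one_iff : IsPBlocked 1 ψ ↔ ∃ u, ψ = productVec u`** (Jozsa–Linden's
  `1`-blocked states are exactly the product vectors);
* **`fullySeparableCone n : Set (Matrix (QReg n) (QReg n) ℂ)`** — written EXACTLY as the route's
  inline condition (`mem_fullySeparableCone_iff` is `Iff.rfl`), and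
  **`IsSeparableState ρ :↔ ρ ∈ fullySeparableCone n ∧ tr ρ = 1`**;
* cone structure: `zero_mem_`, `add_mem_`, `smul_mem_` (`c ≥ 0`), `finsetSum_mem_`,
  `convex_fullySeparableCone`, `sum_smul_vecMulVec_mem` (any finite index type), `vecMulVec_mem`,
  `vecMulVec_smul_mem` (`|cφ⟩⟨cφ| = |c|²|φ⟩⟨φ|`, `vecMulVec_smul_star`), `posSemidef_of_mem`;
* `linearMap_mem_fullySeparableCone` — a `ℂ`-linear map on operators sending product projectors
  into the cone maps the cone into the cone (the mechanism of all stability statements);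
* `productOp P = ⊗ⱼ Pⱼ` and **`productOp_mem_fullySeparableCone`** (products of positive
  semidefinite single-qubit operators are fully separable; `Pⱼ = Bⱼᴴ Bⱼ` and expansion over the
  `2ⁿ` row choices), `productOp_vecMulVec`, `isSeparableState_productOp` (trace-one factors);
* wire-`0` operations as linear maps with their action on product projectors and the stability of
  the cone: **`tensorHead P`** (`P ⊗ M`; `tensorHead_mem_fullySeparableCone` for `P ≥ 0`),
  **`conjHead V`** (`(V ⊗ 1) M (V ⊗ 1)†`, any `V`; `conjHead_mem_fullySeparableCone`),
  **`contractHead v`** (`(⟨v| ⊗ 1) M (|v⟩ ⊗ 1)`; `contractHead_mem_fullySeparableCone`;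
  `contractHead_basis_apply` = the block `⟨b|₀ M |b⟩₀`).

## Design / not included

* The new / acted-on qubit is always wire `0` (`Fin.cons`, `Fin.tail`, matching the route's
  `FactorTwoLemma`, which writes `y 0` and `Fin.tail y`); other wires follow by permuting wires,
  which is not set up here.
* Closedness of the cone (true: it is generated by the compact set of product projectors of unit
  vectors, via Carathéodory) is NOT proved here; nor is any entanglement criterion (PPT, …).
* Mathlib: `Matrix.PosSemidef`, `Matrix.vecMulVec`, `posSemidef_vecMulVec_self_star`,
  `posSemidef_sum`, and `CStarAlgebra.nonneg_iff_eq_star_mul_self` (under `open scoped MatrixOrder`)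
  for `P = Bᴴ B`; Mathlib has no notion of separable state / operator (searched `separable`
  (only field-theoretic and topological), `productState`, `entangle`).

## References

* I. Bengtsson, K. Życzkowski, *Geometry of Quantum States: An Introduction to Quantum
  Entanglement*, 2nd ed., Cambridge University Press (2017), Ch. 16, Definition 16.2, eq. (16.50)
  and the following paragraph (extreme points = separable pure states). [BengtssonZyczkowski2017]
* R. F. Werner, *Quantum states with Einstein–Podolsky–Rosen correlations admitting a
  hidden-variable model*, Phys. Rev. A 40 (1989) 4277–4281 (origin of the definition, per
  Bengtsson–Życzkowski's footnote; not re-read here). [Werner1989]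
* R. Jozsa, N. Linden, Proc. R. Soc. A 459 (2003) (`p`-blocked states; `IsPBlocked`).
  [JozsaLinden2003]
-/

noncomputable section

open Matrix Finset Literature.Computability.Cryptography Literature.Barriers.QuantumAdvantage
open scoped BigOperators ComplexConjugate ComplexOrder

namespace Literature.Computability.QuantumComplexity

variable {n : ℕ}

/-! ### Product vectors (`1`-blocked pure states) -/

/-- The **product vector** `⊗ⱼ uⱼ` with single-qubit factors `u j : Bool → ℂ`:
`(⊗ⱼ uⱼ)(x) = ∏ⱼ uⱼ(xⱼ)` on the register `QReg n = Fin n → Bool`.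
[cite: BengtssonZyczkowski2017, Ch. 16, Definition 16.2 (product states)] -/
def productVec (u : Fin n → Bool → ℂ) : QReg n → ℂ :=
  fun x => ∏ j, u j (x j)

/-- A product vector is `1`-blocked in the sense of Jozsa–Linden (`IsPBlocked 1`: every wire is
its own block). [cite: JozsaLinden2003, §3 (definition of p-blocked)] -/
theorem isPBlocked_one_productVec (u : Fin n → Bool → ℂ) : IsPBlocked 1 (productVec u) := by
  classical
  refine ⟨fun i => (i : ℕ), fun k => ?_, fun k x => if h : k < n then u ⟨k, h⟩ (x ⟨k, h⟩) else 1,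
    fun k x y hxy => ?_, fun x => ?_⟩
  · -- each block `{i : (i : ℕ) = k}` has at most one wire
    refine Finset.card_le_one.2 fun a ha b hb => ?_
    simp only [Finset.mem_filter, Finset.mem_univ, true_and] at ha hb
    exact Fin.ext (ha.trans hb.symm)
  · by_cases h : k < n
    · simp only [dif_pos h, hxy ⟨k, h⟩ rfl]
    · simp only [dif_neg h]
  · rw [Finset.prod_image (g := fun i : Fin n => (i : ℕ)) fun i _ j _ hij => Fin.ext hij]
    simp only [productVec, Fin.is_lt, dif_pos, Fin.eta]

/-- **`1`-blocked states are exactly the product vectors** (for the register `Fin n → Bool`):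
`IsPBlocked 1 ψ ↔ ∃ u, ψ = ⊗ⱼ uⱼ`. [cite: JozsaLinden2003, §3 (definition of p-blocked)] -/
theorem isPBlocked_one_iff (ψ : QReg n → ℂ) :
    IsPBlocked 1 ψ ↔ ∃ u : Fin n → Bool → ℂ, ψ = productVec u := by
  classical
  constructor
  · rintro ⟨blk, hcard, φ, hdep, hψ⟩
    -- blocks of size `≤ 1`: the labelling is injective
    have hinj : Function.Injective blk := by
      intro i j hij
      have h1 := Finset.card_le_one.1 (hcard (blk j)) i (by simp [hij]) j (by simp)
      exact h1
    let x₀ : QReg n := fun _ => false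
    refine ⟨fun j b => φ (blk j) (Function.update x₀ j b), funext fun x => ?_⟩
    rw [hψ, productVec, Finset.prod_image (g := blk) fun i _ j _ hij => hinj hij]
    refine Finset.prod_congr rfl fun j _ => hdep (blk j) x (Function.update x₀ j (x j)) fun i hi => ?_
    rw [hinj hi, Function.update_self]
  · rintro ⟨u, rfl⟩
    exact isPBlocked_one_productVec u

/-! ### The cone of fully separable operators -/

/-- **The cone of fully separable (unnormalised) `n`-qubit operators**: finite nonnegative
combinations `Σᵢ wᵢ |φᵢ⟩⟨φᵢ|` of projectors onto fully product vectors `φᵢ` (each `φᵢ` `1`-blocked,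
`IsPBlocked 1`, i.e. `φᵢ = ⊗ⱼ uᵢⱼ`, `isPBlocked_one_iff`) — Werner's classically correlated /
separable states before normalisation ("`W = Σᵢ pᵢ W¹ᵢ ⊗ W²ᵢ`", here fully multipartite and with
pure product factors, which generate the same cone). Written EXACTLY as the condition inlined in
the route statements of `QuantumAdvantage/SeparableFrames` (`SeparableInstancesInBPP`,
`TwoQubitFrameExactness`, `FactorTwoLemma`), so that `M ∈ fullySeparableCone n` unfolds to it by
`Iff.rfl`. [cite: BengtssonZyczkowski2017, Ch. 16, Definition 16.2, eq. (16.50) and the following paragraph] -/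
def fullySeparableCone (n : ℕ) : Set (Matrix (QReg n) (QReg n) ℂ) :=
  {M | ∃ (s : ℕ) (w : Fin s → ℝ) (φ : Fin s → QReg n → ℂ),
    (∀ i, 0 ≤ w i ∧ IsPBlocked 1 (φ i)) ∧ M = ∑ i, (w i : ℂ) • Matrix.vecMulVec (φ i) (star (φ i))}

/-- **Separable (mixed) state** of `n` qubits: a trace-one element of the fully separable cone
(Bengtsson–Życzkowski, Definition 16.2: "convex sum of product states … the weights are positive … and
sum to unity"). [cite: BengtssonZyczkowski2017, Ch. 16, Definition 16.2, eq. (16.50)] -/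
def IsSeparableState (ρ : Matrix (QReg n) (QReg n) ℂ) : Prop :=
  ρ ∈ fullySeparableCone n ∧ ρ.trace = 1

/-- Unfolding to the route's inline condition. [folklore] -/
theorem mem_fullySeparableCone_iff (M : Matrix (QReg n) (QReg n) ℂ) :
    M ∈ fullySeparableCone n ↔ ∃ (s : ℕ) (w : Fin s → ℝ) (φ : Fin s → QReg n → ℂ),
      (∀ i, 0 ≤ w i ∧ IsPBlocked 1 (φ i)) ∧
        M = ∑ i, (w i : ℂ) • Matrix.vecMulVec (φ i) (star (φ i)) :=
  Iff.rfl

/-- Any finite nonnegative combination of product projectors (indexed by an arbitrary finite type)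
lies in the cone. [folklore] -/
theorem sum_smul_vecMulVec_mem {ι : Type*} [Fintype ι] (w : ι → ℝ) (φ : ι → QReg n → ℂ)
    (hw : ∀ i, 0 ≤ w i) (hφ : ∀ i, IsPBlocked 1 (φ i)) :
    (∑ i, (w i : ℂ) • Matrix.vecMulVec (φ i) (star (φ i))) ∈ fullySeparableCone n := by
  classical
  let e := Fintype.equivFin ι
  refine ⟨Fintype.card ι, w ∘ e.symm, φ ∘ e.symm, fun i => ⟨hw _, hφ _⟩, ?_⟩
  exact (e.symm.sum_comp (fun i => (w i : ℂ) • Matrix.vecMulVec (φ i) (star (φ i)))).symm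

/-- A single product projector `|φ⟩⟨φ|` lies in the cone. [folklore] -/
theorem vecMulVec_mem {φ : QReg n → ℂ} (hφ : IsPBlocked 1 φ) :
    Matrix.vecMulVec φ (star φ) ∈ fullySeparableCone n := by
  have := sum_smul_vecMulVec_mem (ι := Unit) (fun _ => (1 : ℝ)) (fun _ => φ) (fun _ => zero_le_one)
    fun _ => hφ
  simpa using this

/-- `0` lies in the cone (the empty combination). [folklore] -/
theorem zero_mem_fullySeparableCone : (0 : Matrix (QReg n) (QReg n) ℂ) ∈ fullySeparableCone n :=
  ⟨0, Fin.elim0, Fin.elim0, fun i => i.elim0, by simp⟩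

/-- The cone is stable under addition. [folklore] -/
theorem add_mem_fullySeparableCone {M N : Matrix (QReg n) (QReg n) ℂ}
    (hM : M ∈ fullySeparableCone n) (hN : N ∈ fullySeparableCone n) :
    M + N ∈ fullySeparableCone n := by
  obtain ⟨s, w, φ, h, rfl⟩ := hM
  obtain ⟨s', w', φ', h', rfl⟩ := hN
  have := sum_smul_vecMulVec_mem (ι := Fin s ⊕ Fin s') (Sum.elim w w') (Sum.elim φ φ')
    (fun i => by cases i <;> simp [(h _).1, (h' _).1]) (fun i => by cases i <;> simp [(h _).2, (h' _).2])
  simpa [Fintype.sum_sum_type] using this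

/-- The cone is stable under nonnegative scaling. [folklore] -/
theorem smul_mem_fullySeparableCone {M : Matrix (QReg n) (QReg n) ℂ} (hM : M ∈ fullySeparableCone n)
    {c : ℝ} (hc : 0 ≤ c) : (c : ℂ) • M ∈ fullySeparableCone n := by
  obtain ⟨s, w, φ, h, rfl⟩ := hM
  refine ⟨s, fun i => c * w i, φ, fun i => ⟨mul_nonneg hc (h i).1, (h i).2⟩, ?_⟩
  rw [Finset.smul_sum]
  refine Finset.sum_congr rfl fun i _ => ?_
  rw [smul_smul, Complex.ofReal_mul]

/-- The cone is convex. [folklore] -/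
theorem convex_fullySeparableCone : Convex ℝ (fullySeparableCone n) := by
  intro M hM N hN a b ha hb _
  rw [RCLike.real_smul_eq_coe_smul (K := ℂ) a M, RCLike.real_smul_eq_coe_smul (K := ℂ) b N]
  exact add_mem_fullySeparableCone (smul_mem_fullySeparableCone hM ha)
    (smul_mem_fullySeparableCone hN hb)

/-- Every element of the cone is positive semidefinite (a nonnegative combination of `|φ⟩⟨φ|`).
[folklore] -/
theorem posSemidef_of_mem {M : Matrix (QReg n) (QReg n) ℂ} (hM : M ∈ fullySeparableCone n) :
    M.PosSemidef := by
  obtain ⟨s, w, φ, h, rfl⟩ := hM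
  refine posSemidef_sum _ fun i _ => ?_
  have := (posSemidef_vecMulVec_self_star (φ i)).smul (a := (w i : ℂ)) ?_
  · exact this
  · exact_mod_cast (h i).1

/-- Finite sums of members lie in the cone. [folklore] -/
theorem finsetSum_mem_fullySeparableCone {ι : Type*} (t : Finset ι) {f : ι → Matrix (QReg n) (QReg n) ℂ}
    (h : ∀ i ∈ t, f i ∈ fullySeparableCone n) : (∑ i ∈ t, f i) ∈ fullySeparableCone n := by
  classical
  induction t using Finset.induction_on with
  | empty => simpa using zero_mem_fullySeparableCone
  | insert a t ha ih =>
    rw [Finset.sum_insert ha]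
    exact add_mem_fullySeparableCone (h a (Finset.mem_insert_self a t))
      (ih fun i hi => h i (Finset.mem_insert_of_mem hi))

/-- **Linear maps preserving product projectors preserve the cone**: if a `ℂ`-linear map on
operators sends every product projector `|φ⟩⟨φ|` into the cone, it maps the cone into the cone
(the mechanism behind stability under local operations, partial projections and tensoring).
[folklore] -/
theorem linearMap_mem_fullySeparableCone {m m' : ℕ}
    (T : Matrix (QReg m) (QReg m) ℂ →ₗ[ℂ] Matrix (QReg m') (QReg m') ℂ)
    (hT : ∀ φ : QReg m → ℂ, IsPBlocked 1 φ → T (Matrix.vecMulVec φ (star φ)) ∈ fullySeparableCone m')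
    {M : Matrix (QReg m) (QReg m) ℂ} (hM : M ∈ fullySeparableCone m) :
    T M ∈ fullySeparableCone m' := by
  obtain ⟨s, w, φ, h, rfl⟩ := hM
  rw [map_sum]
  refine finsetSum_mem_fullySeparableCone _ fun i _ => ?_
  rw [map_smul]
  exact smul_mem_fullySeparableCone (hT _ (h i).2) (h i).1

/-- Rescaling the vector rescales the projector by `|c|²`: `|cφ⟩⟨cφ| = |c|² |φ⟩⟨φ|`. [folklore] -/
theorem vecMulVec_smul_star (c : ℂ) (φ : QReg n → ℂ) :
    Matrix.vecMulVec (c • φ) (star (c • φ)) = ((Complex.normSq c : ℝ) : ℂ) • Matrix.vecMulVec φ (star φ) := by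
  ext x y
  simp only [Matrix.vecMulVec_apply, Pi.smul_apply, Pi.star_apply, smul_eq_mul, Complex.star_def,
    map_mul, Matrix.smul_apply, Complex.normSq_eq_conj_mul_self]
  ring

/-- A scalar multiple of a product projector lies in the cone. [folklore] -/
theorem vecMulVec_smul_mem {φ : QReg n → ℂ} (hφ : IsPBlocked 1 φ) (c : ℂ) :
    Matrix.vecMulVec (c • φ) (star (c • φ)) ∈ fullySeparableCone n := by
  rw [vecMulVec_smul_star]
  exact smul_mem_fullySeparableCone (vecMulVec_mem hφ) (Complex.normSq_nonneg c)

/-! ### Product vectors one wire at a time -/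

/-- `⊗ (u₀, u) = u₀ ⊗ (⊗ u)`: peeling off wire `0`. [folklore] -/
theorem productVec_cons (u₀ : Bool → ℂ) (u : Fin n → Bool → ℂ) (y : QReg (n + 1)) :
    productVec (Fin.cons u₀ u : Fin (n + 1) → Bool → ℂ) y = u₀ (y 0) * productVec u (Fin.tail y) := by
  simp only [productVec, Fin.prod_univ_succ, Fin.cons_zero, Fin.cons_succ, Fin.tail]

/-! ### Product operators `⊗ⱼ Pⱼ` with positive semidefinite single-qubit factors -/

/-- The **product operator** `⊗ⱼ Pⱼ` of single-qubit operators `P j : Matrix Bool Bool ℂ`: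
`(⊗ⱼ Pⱼ)_{x,y} = ∏ⱼ (Pⱼ)_{xⱼ yⱼ}`. [cite: BengtssonZyczkowski2017, Ch. 16, Definition 16.2 (product states)] -/
def productOp (P : Fin n → Matrix Bool Bool ℂ) : Matrix (QReg n) (QReg n) ℂ :=
  Matrix.of fun x y => ∏ j, P j (x j) (y j)

/-- The product of projectors is the projector onto the product vector:
`⊗ⱼ |uⱼ⟩⟨uⱼ| = |⊗ⱼuⱼ⟩⟨⊗ⱼuⱼ|`. [folklore] -/
theorem productOp_vecMulVec (u : Fin n → Bool → ℂ) :
    productOp (fun j => Matrix.vecMulVec (u j) (star (u j))) =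
      Matrix.vecMulVec (productVec u) (star (productVec u)) := by
  ext x y
  simp only [productOp, Matrix.of_apply, Matrix.vecMulVec_apply, Pi.star_apply, productVec,
    Complex.star_def, map_prod, ← Finset.prod_mul_distrib]

/-- **Products of positive semidefinite single-qubit operators are fully separable**: writing each
factor as `Pⱼ = Bⱼᴴ Bⱼ`, the product `⊗ⱼ Pⱼ` is the sum, over the `2ⁿ` choices `τ` of a row in each
factor, of the projectors onto the product vectors `⊗ⱼ conj(Bⱼ)_{τⱼ, ·}`.
[cite: BengtssonZyczkowski2017, Ch. 16, Definition 16.2 and the following paragraph (separable pure states are the extreme points)] -/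
theorem productOp_mem_fullySeparableCone {P : Fin n → Matrix Bool Bool ℂ}
    (hP : ∀ j, (P j).PosSemidef) : productOp P ∈ fullySeparableCone n := by
  classical
  -- factor each `Pⱼ = star Bⱼ * Bⱼ`
  have hB : ∀ j, ∃ B : Matrix Bool Bool ℂ, P j = star B * B := fun j => by
    open scoped MatrixOrder in exact CStarAlgebra.nonneg_iff_eq_star_mul_self.mp (hP j).nonneg
  choose B hB using hB
  -- the product vectors indexed by a choice of row in each factor
  let u : (Fin n → Bool) → Fin n → Bool → ℂ := fun τ j b => conj (B j (τ j) b)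
  have key : productOp P = ∑ τ : Fin n → Bool, Matrix.vecMulVec (productVec (u τ)) (star (productVec (u τ))) := by
    ext x y
    simp only [productOp, Matrix.of_apply, Matrix.sum_apply, Matrix.vecMulVec_apply, Pi.star_apply,
      productVec]
    have hentry : ∀ j, P j (x j) (y j) = ∑ t : Bool, conj (B j t (x j)) * B j t (y j) := fun j => by
      rw [hB j, Matrix.mul_apply]
      rfl
    simp only [hentry, Fintype.prod_sum]
    refine Finset.sum_congr rfl fun τ _ => ?_
    simp only [u, Complex.star_def, map_prod, Complex.conj_conj, ← Finset.prod_mul_distrib]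
  rw [key]
  refine finsetSum_mem_fullySeparableCone _ fun τ _ => vecMulVec_mem (isPBlocked_one_productVec _)

/-! ### Tensoring with a single-qubit operator on a new wire `0` -/

/-- `P ⊗ M` on `n + 1` qubits (the new qubit is wire `0`): `(P ⊗ M)_{y,z} = P_{y₀ z₀} M_{tail y, tail z}`.
[cite: BengtssonZyczkowski2017, Ch. 16, Definition 16.2 (product states)] -/
def tensorHead (P : Matrix Bool Bool ℂ) : Matrix (QReg n) (QReg n) ℂ →ₗ[ℂ] Matrix (QReg (n + 1)) (QReg (n + 1)) ℂ where
  toFun M := Matrix.of fun y z => P (y 0) (z 0) * M (Fin.tail y) (Fin.tail z)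
  map_add' M N := by ext y z; simp [mul_add]
  map_smul' c M := by ext y z; simp only [Matrix.of_apply, Matrix.smul_apply, smul_eq_mul, RingHom.id_apply]; ring

/-- Entries of `tensorHead`. [folklore] -/
@[simp] theorem tensorHead_apply (P : Matrix Bool Bool ℂ) (M : Matrix (QReg n) (QReg n) ℂ) (y z : QReg (n + 1)) :
    tensorHead P M y z = P (y 0) (z 0) * M (Fin.tail y) (Fin.tail z) := rfl

/-- `|u⟩⟨u| ⊗ |φ⟩⟨φ| = |u ⊗ φ⟩⟨u ⊗ φ|`. [folklore] -/
theorem tensorHead_vecMulVec (u₀ : Bool → ℂ) (u : Fin n → Bool → ℂ) :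
    tensorHead (Matrix.vecMulVec u₀ (star u₀)) (Matrix.vecMulVec (productVec u) (star (productVec u))) =
      Matrix.vecMulVec (productVec (Fin.cons u₀ u : Fin (n + 1) → Bool → ℂ))
        (star (productVec (Fin.cons u₀ u : Fin (n + 1) → Bool → ℂ))) := by
  ext y z
  simp only [tensorHead_apply, Matrix.vecMulVec_apply, Pi.star_apply, Complex.star_def,
    productVec_cons, map_mul]
  ring

/-- **Tensoring with a positive semidefinite single-qubit operator preserves the cone.**
[cite: BengtssonZyczkowski2017, Ch. 16, Definition 16.2] -/
theorem tensorHead_mem_fullySeparableCone {P : Matrix Bool Bool ℂ} (hP : P.PosSemidef)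
    {M : Matrix (QReg n) (QReg n) ℂ} (hM : M ∈ fullySeparableCone n) :
    tensorHead P M ∈ fullySeparableCone (n + 1) := by
  classical
  obtain ⟨B, hB⟩ : ∃ B : Matrix Bool Bool ℂ, P = star B * B := by
    open scoped MatrixOrder in exact CStarAlgebra.nonneg_iff_eq_star_mul_self.mp hP.nonneg
  refine linearMap_mem_fullySeparableCone (tensorHead P) (fun φ hφ => ?_) hM
  obtain ⟨u, rfl⟩ := (isPBlocked_one_iff φ).1 hφ
  -- `P = Σ_t |conj B_t⟩⟨conj B_t|`, so `P ⊗ |φ⟩⟨φ| = Σ_t |conj B_t ⊗ φ⟩⟨…|`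
  have hP' : P = ∑ t : Bool, Matrix.vecMulVec (fun b => conj (B t b)) (star fun b => conj (B t b)) := by
    ext a c
    rw [hB, Matrix.mul_apply, Matrix.sum_apply]
    refine Finset.sum_congr rfl fun t _ => ?_
    simp [Matrix.vecMulVec_apply]
  have : tensorHead P (Matrix.vecMulVec (productVec u) (star (productVec u))) =
      ∑ t : Bool, Matrix.vecMulVec (productVec (Fin.cons (fun b => conj (B t b)) u : Fin (n + 1) → Bool → ℂ))
        (star (productVec (Fin.cons (fun b => conj (B t b)) u : Fin (n + 1) → Bool → ℂ))) := by
    conv_lhs => rw [hP']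
    ext y z
    simp only [tensorHead_apply, Matrix.sum_apply, Finset.sum_mul]
    refine Finset.sum_congr rfl fun t _ => ?_
    have := congrFun (congrFun (tensorHead_vecMulVec (n := n) (fun b => conj (B t b)) u) y) z
    simpa only [tensorHead_apply] using this
  rw [this]
  exact finsetSum_mem_fullySeparableCone _ fun t _ => vecMulVec_mem (isPBlocked_one_productVec _)

/-! ### Local operations and partial projections on wire `0` -/

/-- **Local operation on wire `0`**: `M ↦ (V ⊗ 1) M (V ⊗ 1)†` for a single-qubit matrix `V`
(not necessarily unitary: measurements / Kraus operators included).
[cite: BengtssonZyczkowski2017, Ch. 16, Definition 16.2 ("Separable states … can be constructed locally")] -/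
def conjHead (V : Matrix Bool Bool ℂ) :
    Matrix (QReg (n + 1)) (QReg (n + 1)) ℂ →ₗ[ℂ] Matrix (QReg (n + 1)) (QReg (n + 1)) ℂ where
  toFun M := Matrix.of fun y z =>
    ∑ a, ∑ c, V (y 0) a * M (Fin.cons a (Fin.tail y)) (Fin.cons c (Fin.tail z)) * conj (V (z 0) c)
  map_add' M N := by
    ext y z
    simp only [Matrix.of_apply, Matrix.add_apply, mul_add, add_mul, Finset.sum_add_distrib]
  map_smul' c M := by
    ext y z
    simp only [Matrix.of_apply, Matrix.smul_apply, smul_eq_mul, RingHom.id_apply, Finset.mul_sum]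
    refine Finset.sum_congr rfl fun a _ => Finset.sum_congr rfl fun c' _ => ?_
    ring

/-- `(V ⊗ 1)|u₀ ⊗ ⊗u⟩⟨…|(V ⊗ 1)† = |V u₀ ⊗ ⊗u⟩⟨…|`: a local operation maps product projectors to
product projectors. [folklore] -/
theorem conjHead_vecMulVec (V : Matrix Bool Bool ℂ) (u₀ : Bool → ℂ) (u : Fin n → Bool → ℂ) :
    conjHead V (Matrix.vecMulVec (productVec (Fin.cons u₀ u : Fin (n + 1) → Bool → ℂ))
        (star (productVec (Fin.cons u₀ u : Fin (n + 1) → Bool → ℂ)))) =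
      Matrix.vecMulVec (productVec (Fin.cons (V.mulVec u₀) u : Fin (n + 1) → Bool → ℂ))
        (star (productVec (Fin.cons (V.mulVec u₀) u : Fin (n + 1) → Bool → ℂ))) := by
  ext y z
  simp only [conjHead, LinearMap.coe_mk, AddHom.coe_mk, Matrix.of_apply, Matrix.vecMulVec_apply,
    Pi.star_apply, Complex.star_def, productVec_cons, Fin.cons_zero, Fin.tail_cons, Matrix.mulVec,
    dotProduct, map_sum, map_mul, Finset.sum_mul, Finset.mul_sum]
  rw [Finset.sum_comm]
  refine Finset.sum_congr rfl fun a _ => Finset.sum_congr rfl fun c _ => ?_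
  ring

/-- **Local operations on a wire preserve the cone** (`M ↦ (V ⊗ 1) M (V ⊗ 1)†`, any single-qubit
`V`, on wire `0`). [cite: BengtssonZyczkowski2017, Definition 16.2 (separable states; local operations)] -/
theorem conjHead_mem_fullySeparableCone (V : Matrix Bool Bool ℂ) {M : Matrix (QReg (n + 1)) (QReg (n + 1)) ℂ}
    (hM : M ∈ fullySeparableCone (n + 1)) : conjHead V M ∈ fullySeparableCone (n + 1) := by
  refine linearMap_mem_fullySeparableCone (conjHead V) (fun φ hφ => ?_) hM
  obtain ⟨w, rfl⟩ := (isPBlocked_one_iff φ).1 hφ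
  have hw : w = Fin.cons (w 0) (Fin.tail w) := (Fin.cons_self_tail w).symm
  rw [hw, conjHead_vecMulVec]
  exact vecMulVec_mem (isPBlocked_one_productVec _)

/-- **Partial projection of wire `0` onto a single-qubit vector `v`**: `M ↦ (⟨v| ⊗ 1) M (|v⟩ ⊗ 1)`,
an operator on the remaining `n` qubits; for `v` a basis vector this is the block `⟨b|₀ M |b⟩₀`.
[cite: BengtssonZyczkowski2017, Definition 16.2] -/
def contractHead (v : Bool → ℂ) :
    Matrix (QReg (n + 1)) (QReg (n + 1)) ℂ →ₗ[ℂ] Matrix (QReg n) (QReg n) ℂ where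
  toFun M := Matrix.of fun y z => ∑ a, ∑ c, conj (v a) * M (Fin.cons a y) (Fin.cons c z) * v c
  map_add' M N := by
    ext y z
    simp only [Matrix.of_apply, Matrix.add_apply, mul_add, add_mul, Finset.sum_add_distrib]
  map_smul' c M := by
    ext y z
    simp only [Matrix.of_apply, Matrix.smul_apply, smul_eq_mul, RingHom.id_apply, Finset.mul_sum]
    refine Finset.sum_congr rfl fun a _ => Finset.sum_congr rfl fun c' _ => ?_
    ring

/-- On a product projector the partial projection gives the projector onto the rescaled product
vector of the remaining wires: `(⟨v| ⊗ 1)|u₀ ⊗ ⊗u⟩⟨…|(|v⟩ ⊗ 1) = |⟨v,u₀⟩|² |⊗u⟩⟨⊗u|`. [folklore] -/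
theorem contractHead_vecMulVec (v u₀ : Bool → ℂ) (u : Fin n → Bool → ℂ) :
    contractHead v (Matrix.vecMulVec (productVec (Fin.cons u₀ u : Fin (n + 1) → Bool → ℂ))
        (star (productVec (Fin.cons u₀ u : Fin (n + 1) → Bool → ℂ)))) =
      Matrix.vecMulVec ((∑ a, conj (v a) * u₀ a) • productVec u)
        (star ((∑ a, conj (v a) * u₀ a) • productVec u)) := by
  ext y z
  simp only [contractHead, LinearMap.coe_mk, AddHom.coe_mk, Matrix.of_apply, Matrix.vecMulVec_apply,
    Pi.star_apply, Pi.smul_apply, smul_eq_mul, Complex.star_def, productVec_cons, Fin.cons_zero,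
    Fin.tail_cons, map_sum, map_mul, Complex.conj_conj, Finset.sum_mul, Finset.mul_sum]
  rw [Finset.sum_comm]
  refine Finset.sum_congr rfl fun a _ => Finset.sum_congr rfl fun c _ => ?_
  ring

/-- **Partial projections of a wire preserve the cone** (`M ↦ (⟨v| ⊗ 1) M (|v⟩ ⊗ 1)`).
[cite: BengtssonZyczkowski2017, Definition 16.2] -/
theorem contractHead_mem_fullySeparableCone (v : Bool → ℂ) {M : Matrix (QReg (n + 1)) (QReg (n + 1)) ℂ}
    (hM : M ∈ fullySeparableCone (n + 1)) : contractHead v M ∈ fullySeparableCone n := by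
  refine linearMap_mem_fullySeparableCone (contractHead v) (fun φ hφ => ?_) hM
  obtain ⟨w, rfl⟩ := (isPBlocked_one_iff φ).1 hφ
  have hw : w = Fin.cons (w 0) (Fin.tail w) := (Fin.cons_self_tail w).symm
  rw [hw, contractHead_vecMulVec]
  exact vecMulVec_smul_mem (isPBlocked_one_productVec _) _

/-- The block `⟨b|₀ M |b⟩₀` of `M` (wire `0` projected onto the basis state `b`) is the partial
projection onto the basis vector. [folklore] -/
theorem contractHead_basis_apply (b : Bool) (M : Matrix (QReg (n + 1)) (QReg (n + 1)) ℂ) (y z : QReg n) :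
    contractHead (fun a => if a = b then 1 else 0) M y z = M (Fin.cons b y) (Fin.cons b z) := by
  simp [contractHead]

/-! ### Separable states -/

/-- A separable state is a density operator (positive semidefinite of trace one). [folklore] -/
theorem IsSeparableState.posSemidef {ρ : Matrix (QReg n) (QReg n) ℂ} (h : IsSeparableState ρ) :
    ρ.PosSemidef :=
  posSemidef_of_mem h.1

/-- Product states of single-qubit density matrices are separable states: `⊗ⱼ ρⱼ` with each `ρⱼ`
positive semidefinite of trace one. [cite: BengtssonZyczkowski2017, Definition 16.2] -/
theorem isSeparableState_productOp {P : Fin n → Matrix Bool Bool ℂ} (hP : ∀ j, (P j).PosSemidef)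
    (htr : ∀ j, (P j).trace = 1) : IsSeparableState (productOp P) := by
  refine ⟨productOp_mem_fullySeparableCone hP, ?_⟩
  simp only [Matrix.trace, Matrix.diag, productOp, Matrix.of_apply]
  rw [← Fintype.prod_sum fun j (b : Bool) => P j b b]
  · exact Finset.prod_eq_one fun j _ => by simpa [Matrix.trace, Matrix.diag] using htr j

/-! ### The identity, basis projectors and the maximally mixed state

(Appended for route `QuantumAdvantage/SeparableFrames`: the separable radius
`s_sym(T) = sup {β : 1 ± βT ∈ cone}` and the body `𝒜_n = {A : 1 ± A ∈ cone}` need `1 ∈ cone`.) -/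

/-- Computational basis states `|x⟩` are `1`-blocked (product) vectors. [folklore] -/
theorem isPBlocked_one_basisState (x : QReg n) : IsPBlocked 1 (basisState x) := by
  classical
  refine (isPBlocked_one_iff _).2 ⟨fun i b => if b = x i then 1 else 0, funext fun y => ?_⟩
  rw [basisState_apply, productVec, Fintype.prod_boole]
  by_cases h : y = x
  · subst h
    simp
  · have h' : ¬ ∀ i, y i = x i := fun hall => h (funext hall)
    rw [if_neg h, if_neg h']

/-- The projector `|x⟩⟨x|` onto a computational basis state lies in the cone. [folklore] -/
theorem vecMulVec_basisState_mem_fullySeparableCone (x : QReg n) :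
    Matrix.vecMulVec (basisState x) (star (basisState x)) ∈ fullySeparableCone n :=
  vecMulVec_mem (isPBlocked_one_basisState x)

/-- `⊗ⱼ 1 = 1` on `n` qubits. [folklore] -/
theorem productOp_one : productOp (fun _ : Fin n => (1 : Matrix Bool Bool ℂ)) = 1 := by
  classical
  ext x y
  simp only [productOp, Matrix.of_apply, Matrix.one_apply, Fintype.prod_boole]
  by_cases h : x = y
  · subst h
    simp
  · have h' : ¬ ∀ j, x j = y j := fun hall => h (funext hall)
    rw [if_neg h', if_neg h]

/-- **The identity is fully separable**: `1 = ⊗ⱼ 1 ∈ fullySeparableCone n` (equivalently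
`1 = Σₓ |x⟩⟨x|`); in particular the sets `{β : 1 ± βT ∈ cone}` defining separable radii are
nonempty. [folklore] -/
theorem one_mem_fullySeparableCone : (1 : Matrix (QReg n) (QReg n) ℂ) ∈ fullySeparableCone n := by
  rw [← productOp_one]
  exact productOp_mem_fullySeparableCone fun _ => Matrix.PosSemidef.one

/-- Nonnegative real multiples of the identity lie in the cone. [folklore] -/
theorem smul_one_mem_fullySeparableCone {c : ℝ} (hc : 0 ≤ c) :
    (c : ℂ) • (1 : Matrix (QReg n) (QReg n) ℂ) ∈ fullySeparableCone n :=
  smul_mem_fullySeparableCone one_mem_fullySeparableCone hc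

/-- The cone is stable under the real scalar action by nonnegative reals (`c • M` with `c : ℝ`).
[folklore] -/
theorem real_smul_mem_fullySeparableCone {M : Matrix (QReg n) (QReg n) ℂ}
    (hM : M ∈ fullySeparableCone n) {c : ℝ} (hc : 0 ≤ c) : c • M ∈ fullySeparableCone n := by
  rw [RCLike.real_smul_eq_coe_smul (K := ℂ) c M]
  exact smul_mem_fullySeparableCone hM hc

/-- Members of the cone are Hermitian. [folklore] -/
theorem isHermitian_of_mem {M : Matrix (QReg n) (QReg n) ℂ} (hM : M ∈ fullySeparableCone n) :
    M.IsHermitian :=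
  (posSemidef_of_mem hM).isHermitian

/-- Diagonal entries of a member of the cone are nonnegative reals. [folklore] -/
theorem diag_nonneg_of_mem {M : Matrix (QReg n) (QReg n) ℂ} (hM : M ∈ fullySeparableCone n)
    (x : QReg n) : 0 ≤ M x x :=
  (posSemidef_of_mem hM).diag_nonneg

/-- **The maximally mixed state `2⁻ⁿ · 1` is separable.** [folklore] -/
theorem isSeparableState_maximallyMixed :
    IsSeparableState (((2 : ℂ) ^ n)⁻¹ • (1 : Matrix (QReg n) (QReg n) ℂ)) := by
  refine ⟨?_, ?_⟩
  · have h : ((2 : ℂ) ^ n)⁻¹ = ((((2 : ℝ) ^ n)⁻¹ : ℝ) : ℂ) := by push_cast; rfl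
    rw [h]
    exact smul_one_mem_fullySeparableCone (by positivity)
  · rw [Matrix.trace_smul, Matrix.trace_one, Fintype.card_fun, Fintype.card_bool, Fintype.card_fin,
      smul_eq_mul]
    push_cast
    exact inv_mul_cancel₀ (pow_ne_zero n two_ne_zero)

end Literature.Computability.QuantumComplexity

end
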